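import Summits.ResolutionOfSingularities.ResolutionOfSingularities.Theorems.HilbertSamuelEliminationCampaignW42ToricMarkedPhase
import Summits.ResolutionOfSingularities.ResolutionOfSingularities.Theorems.HilbertSamuelEliminationSigmaMaxModificationsCorridor3SigmaCornerPuzzle
import Mathlib.Algebra.BigOperators.Fin
import Mathlib.Data.Rat.Lemmas

/-!
# [OURS · L1 W4.2] Toric marked monomial objects in dimension 3 — brick 7A: W-TOP POSITIONS (the id-model twin of `InitialCornerSolvable`)

[OURS · L1 W4.2 · seat res-L1-s42-pv-2 gen 5] Memo `L/res-L1-s42-pv-2/CALIBRATION-W42-O2-v4.md` §4.  For a position `A ⊂ ℚ³_{≥0}` of Hironaka's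
polyhedra game (`Literature…Spivakovsky1983.IsPosition`, the vocabulary of idea-2's row `IdeasL1Idea2R8.InitialCornerSolvable`), clear denominators
(`m` = a common denominator) and form the initial toric marked monomial state with integer exponents `a_k(v) = m·v_k` (generator index type = the
elements of `A`); by brick 6C it is E-resolvable by legal blow-ups (`eresolvable_of_isPosition`).  This is the ID-MODEL TWIN of the row: the dictionary
to `cornerPuzzle A` (rays named by VECTORS, `Won = ≤`, activity clause) needs the fan property of reachable `HStage`s and the replay-with-skips lemma
(memo §4, bridges B2/B1) and is NOT proved here.  NOT a statement of the manuscript under review nor of Spivakovsky / Blanco / Encinas–Villamayor.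
AI work, weaker than expert review.  No `sorry`, no new axiom.
-/

set_option linter.dupNamespace false -- mandated namespace of this single-conjunct summit

namespace Summit.ResolutionOfSingularities.ResolutionOfSingularities.Theorems.CampaignW42.Toric

open Finset
open Literature.Combinatorics.HironakaPolyhedraGame

namespace TState

/-- A finite set of rationals has a common denominator: some positive natural `m` makes `q · m` a natural number for every non-negative
member... precisely: for every `v ∈ A` and slot `k`, `v k * m` is an integer. -/
theorem exists_common_denominator (A : Finset (Fin 3 → ℚ)) :
    ∃ m : ℕ, 0 < m ∧ ∀ v ∈ A, ∀ k : Fin 3, ∃ z : ℤ, (v k) * m = z := by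
  classical
  refine ⟨∏ v ∈ A, ∏ k : Fin 3, (v k).den, ?_, ?_⟩
  · exact Finset.prod_pos (fun v _ => Finset.prod_pos (fun k _ => (v k).den_pos))
  · intro v hv k
    -- (v k).den divides the big product
    have hdvd : (v k).den ∣ ∏ v ∈ A, ∏ k : Fin 3, (v k).den :=
      (Finset.dvd_prod_of_mem (fun k => (v k).den) (Finset.mem_univ k)).trans (Finset.dvd_prod_of_mem _ hv)
    obtain ⟨c, hc⟩ := hdvd
    refine ⟨(v k).num * c, ?_⟩
    rw [hc]
    push_cast
    have := Rat.mul_den_eq_num (v k)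
    calc v k * (((v k).den : ℚ) * (c : ℚ)) = (v k * (v k).den) * c := by ring
      _ = ((v k).num : ℚ) * c := by rw [this]

/-- **[OURS · L1 W4.2]** The INITIAL TORIC STATE of a position `A` with common denominator `m`: generators indexed by the elements of `A`,
exponent of generator `v` at the coordinate ray `k` equal to the integer `m · v_k`. -/
noncomputable def ofPosition (A : Finset (Fin 3 → ℚ)) (m : ℕ) (hm : ∀ v ∈ A, ∀ k : Fin 3, ∃ z : ℤ, (v k) * m = z) :
    TState {v // v ∈ A} :=
  initial (fun k v => Classical.choose (hm v.1 v.2 k))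

/-- The defining property of the exponents of `ofPosition`: `(a_k(v) : ℚ) = v_k · m`. -/
theorem ofPosition_spec {A : Finset (Fin 3 → ℚ)} {m : ℕ} (hm : ∀ v ∈ A, ∀ k : Fin 3, ∃ z : ℤ, (v k) * m = z) (v : {v // v ∈ A})
    (k : Fin 3) : ((Classical.choose (hm v.1 v.2 k) : ℤ) : ℚ) = v.1 k * m :=
  (Classical.choose_spec (hm v.1 v.2 k)).symm

/-- **[OURS · L1 W4.2] `InitialCornerSolvable` IN THE ID-MODEL.**  For every position `A` of the polyhedra game (non-empty, non-negative rational
generators) there is a marking `m > 0` (a common denominator) such that the initial toric marked monomial state of `A` is E-resolvable by legal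
blow-ups: a finite sequence of blow-ups at faces lying in the multiplicity-`m` locus after which, at every corner, some generator has order `< m`. -/
theorem eresolvable_of_isPosition (A : Finset (Fin 3 → ℚ)) (hA : IsPosition A) :
    ∃ (m : ℕ) (hm : ∀ v ∈ A, ∀ k : Fin 3, ∃ z : ℤ, (v k) * m = z), 0 < m ∧ (ofPosition A m hm).EResolvable m := by
  obtain ⟨m, hmpos, hm⟩ := exists_common_denominator A
  obtain ⟨v₀, hv₀⟩ := hA.1
  haveI : Nonempty {v // v ∈ A} := ⟨⟨v₀, hv₀⟩⟩
  refine ⟨m, hm, hmpos, eresolvable_initial hmpos _ (fun k v => ?_)⟩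
  have h1 : (0 : ℚ) ≤ v.1 k * m := mul_nonneg (hA.2 v.1 v.2 k) (by exact_mod_cast hmpos.le)
  have h2 := ofPosition_spec hm v k
  have : (0 : ℚ) ≤ ((Classical.choose (hm v.1 v.2 k) : ℤ) : ℚ) := by rw [h2]; exact h1
  exact_mod_cast this

end TState

end Summit.ResolutionOfSingularities.ResolutionOfSingularities.Theorems.CampaignW42.Toric
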